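import Summits.BirchSwinnertonDyer.BirchSwinnertonDyer.Theorems.SignedLowerHalvesSmallImageLowerHalfBothSignsRttJunctionShaLocCount
import Literature.NumberTheory.GaloisRepresentations.LocalEulerCharCoprime
import Literature.NumberTheory.GaloisRepresentations.LocalGlobalCohomologyFiniteProofs
import Literature.NumberTheory.GaloisCohomology.PoitouTateFiniteUnramifiedTransport
import HarnessLib

/-!
# Route `SignedLowerHalves`, crux L `SmallImageLowerHalfBothSigns` (stmt-BirchSwinnertonDyer-23599), line `rtt_w3` v30 — stub S3β″ (`stub_junctionPT_ns`), input N5-(i), part 3c: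
# THE LEVELWISE BOUND (B) — `#H¹(Γ_{K_w}, Maps(Γ_K ⧸ U_n, X_k))` IS FINITE AT EVERY PLACE AND UNIFORMLY BOUNDED IN `n` AT A FINITELY DECOMPOSED PLACE `w ∤ p`

WIDTH seat `bsd-line-slh-p3-w3` g26 under LEAD `cruxlead-stmt-BirchSwinnertonDyer-23599` g14 (cell `bsd-ssimc`); helper `--supports stmt-BirchSwinnertonDyer-23599`. THEOREMS ONLY (no definition,
no named fact, no instance, no `sorry`). HONEST FRAMING: discharges hypothesis (B) and the finiteness hypothesis `hfin` of `…RttD2SeqSemilocNakayama` (p817289) for -w3's semilocal levels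
`Lloc_w(n,k) = semilocCoh S κ θ′ P w n k 1` from TREE THEOREMS: `H¹` of a finite module over a local field is finite (`finite_galoisCohomology_one_of_isNonarchimedeanLocalField`); at `w ∤ p`
Tate's local Euler characteristic `#H⁰ · #H² = #H¹` (`natCard_invariants_mul_natCard_two_eq_of_not_dvd`), local duality `(2,0)` (`natCard_two_eq_natCard_invariants_homRep`), honda g28's orbit
count for `Hom` (`natCard_invariants_homRep_coindOpen_le`, `exists_pow_smul_mk_out_eq`) and the orbit count for invariants proved here. The «finitely decomposed» input is honda's `hσ`
(`κ(res σ) = p^e·u₀` for some `σ ∈ Γ_{K_w}`; for the restricted cyclotomic tower at `w ∤ p` it is his `exists_toAdd_restrict_resGalOfEmb_ne_zero`). (E1) remains (part 3b). Nothing about S3β″,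
crux L or BSD is proved; all remain OPEN and are proved for NO curve.

* §1 ★ `natCard_invariants_restrict_coindOpen_le` (GENERIC): invariants of `Maps(G ⧸ N, M)|_θ` are determined on orbit representatives: `#(Maps(G ⧸ N, M)|_θ)^D ≤ #M ^ #ι`.
* §2 `finite_semilocCoh_one` (every place, every level); ★★★ `finite_and_natCard_semilocCoh_one_le` — at `w ∤ p` finitely decomposed:
  `#Lloc_w(n,k) ≤ (#X_k · #Hom(X_k, μ_{p^k}(K̄_w)))^{p^e}` for ALL `n`; `exists_bound_semilocCoh_one` (the `∃ B` form of (B), `k = 1`).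
References: [MilneADT2006] I §2 Thm. 2.8, Cor. 2.3; [SerreGaloisCohomology1997] II §5.2 Prop. 14, §5.7 Thm. 5; [NeukirchSchmidtWingberg2008] (7.2.6), I §5–§6; [Washington1997] §13.2;
[PerrinRiou1994Invent] §1.3.
-/

set_option autoImplicit false
set_option linter.dupNamespace false -- D-0017: single-problem summit, the namespace repeats the problem name by design
noncomputable section

open scoped Classical TensorProduct
open NumberField IsDedekindDomain Field CategoryTheory Function

namespace Summit.BirchSwinnertonDyer.BirchSwinnertonDyer.Theorems.SmallImageRttD2Seq

open Literature.NumberTheory.EllipticCurves Literature.NumberTheory.GaloisRepresentations Literature.NumberTheory.GaloisRepresentations.DiscreteGaloisModule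
  Literature.NumberTheory.ComplexMultiplication.EllipticUnits.JohnsonLeungKings2011
  Summit.BirchSwinnertonDyer.BirchSwinnertonDyer.Theorems.SmallImageRttD2J1 Summit.BirchSwinnertonDyer.BirchSwinnertonDyer.Theorems.SmallImageRttJunctionSha

/-! ## §1. Invariants of a coinduced module are determined on orbit representatives -/

section Invariants

variable {G : Type} [Group G] [TopologicalSpace G] [IsTopologicalGroup G] [CompactSpace G]
  {M : Type} [AddCommGroup M] [TopologicalSpace M] [DiscreteTopology M] [Finite M]
  (ρ : ContinuousRep G ℤ M) (N : Subgroup G) (hN : IsOpen (N : Set G))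
  {D : Type} [Group D] [TopologicalSpace D] [IsTopologicalGroup D] (θ : D →ₜ* G)

omit [IsTopologicalGroup D] in
/-- ★ **Invariants of `Maps(G ⧸ N, M)|_θ` are determined on orbit representatives**: if every coset `y ∈ G ⧸ N` is `θ(h) • r_i` (`h ∈ D`, `r_i` in a finite family `ι`), then
`f ↦ (f(r_i))_i` is injective on the `D`-invariants (`f(θ(h) r_i) = θ(h) f(r_i)`), so `#(Maps(G ⧸ N, M)|_θ)^D ≤ #M ^ #ι`. [cite: NeukirchSchmidtWingberg2008, I §6 (1.6.4)] [cite: Brown1982, III §5 (5.6)(b)] -/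
theorem natCard_invariants_restrict_coindOpen_le {ι : Type} [Fintype ι] (r : ι → G ⧸ N) (hr : ∀ y : G ⧸ N, ∃ (h : D) (i : ι), y = θ h • r i) :
    haveI := ContinuousRep.discreteTopology_coindOpen (M := M) N hN
    Nat.card ((ρ.coindOpen N hN).restrict θ).toTopRep.ρ.invariants ≤ Nat.card M ^ Fintype.card ι := by
  haveI := ContinuousRep.discreteTopology_coindOpen (M := M) N hN
  rw [← Nat.card_eq_fintype_card, ← Nat.card_fun]
  refine Nat.card_le_card_of_injective (fun f ↦ fun i ↦ (f.1 : G ⧸ N → M) (r i)) fun f f' hff' ↦ ?_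
  have key : ∀ f : ((ρ.coindOpen N hN).restrict θ).toTopRep.ρ.invariants, ∀ (h : D) (i : ι),
      (f.1 : G ⧸ N → M) (θ h • r i) = ρ (θ h) ((f.1 : G ⧸ N → M) (r i)) := fun f h i ↦ by
    have hf : ((ρ.coindOpen N hN).restrict θ) h f.1 = f.1 := f.2 h
    have hev := congrFun hf (θ h • r i)
    rw [ContinuousRep.restrict_apply, ContinuousRep.coindOpen_apply_apply, inv_smul_smul] at hev
    exact hev.symm
  apply Subtype.ext
  funext y
  obtain ⟨h, i, rfl⟩ := hr y
  rw [key f h i, key f' h i, show (f.1 : G ⧸ N → M) (r i) = (f'.1 : G ⧸ N → M) (r i) from congrFun hff' i]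

end Invariants

/-! ## §2. The semilocal levels in degree one: finite everywhere, bounded at finitely decomposed `w ∤ p` -/

section Bound

variable {K : Type} [Field K] [NumberField K] {p : ℕ} [Fact p.Prime] (S : Set (PadicAlgCl p)) [FiniteDimensional ℚ_[p] (padicCoeffField S)] (κ : ZpExtension K p)
  (θ' : absoluteGaloisGroup K →ₜ* (padicCoeffIntegers S)ˣ) (P : Set (HeightOneSpectrum (𝓞 K))) (w : HeightOneSpectrum (𝓞 K))

/-- **Every semilocal level `Lloc_w(n,k) = H¹(Γ_{K_w}, Maps(Γ_K ⧸ U_n, X_k))` is finite** (any place `w`): `H¹` of a finite discrete module over a non-archimedean local field.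
[cite: SerreGaloisCohomology1997, II §5.2 Prop. 14] [cite: MilneADT2006, I Cor. 2.3] -/
theorem finite_semilocCoh_one (n k : ℕ) : Finite (semilocCoh S κ θ' P w n k 1) := by
  haveI : CharZero (w.adicCompletion K) := charZero_of_injective_algebraMap (algebraMap K (w.adicCompletion K)).injective
  haveI := SmallImageRttD2J2Delta.finite_coeffGSO P S θ' k
  haveI : Finite (absoluteGaloisGroup K ⧸ κ.layerSubgroup n → (coeffRepK S θ' P k).toTopRep) :=
    ContinuousRep.finite_coindOpen (κ.layerSubgroup n) (κ.isOpen_layerSubgroup n)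
  exact finite_galoisCohomology_one_of_isNonarchimedeanLocalField
    (((coeffRepK S θ' P k).coindOpen (κ.layerSubgroup n) (κ.isOpen_layerSubgroup n)).restrict (resGalOfEmb (closureEmb (K := K) (w.adicCompletion K))))

-- the identification `semilocCoh … n k 1 = H¹(((X_k.coindOpen U_n).restrict res_w).toTopRep)` (two definitionally equal dialects, as in honda's `finite_and_natCard_semilocCoh_two_le`)
-- is checked by `whnf` at the final `exact`; hence the raised heartbeat limit.
set_option maxHeartbeats 800000 in
/-- ★★★ **(B) THE LEVELWISE BOUND**: at a place `w ∤ p` finitely decomposed in `K_∞/K` (some `σ ∈ Γ_{K_w}` with `κ(res σ) = p^e · u₀`), for every `k` and ALL `n`,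
`#Lloc_w(n,k) ≤ (#X_k · #Hom(X_k, μ_{p^k}(K̄_w)))^{p^e}` — Tate's local Euler characteristic `#H⁰ · #H² = #H¹` (`χ = 1` at `w ∤ p`), local duality `(2,0)`, and the two orbit counts over the
`≤ p^e` orbits of `Γ_{K_w}` on `Γ_K ⧸ U_n`. [cite: MilneADT2006, I §2 Thm. 2.8, Cor. 2.3] [cite: NeukirchSchmidtWingberg2008, (7.2.6), I §6 (1.6.4)] [cite: PerrinRiou1994Invent, §1.3] -/
theorem finite_and_natCard_semilocCoh_one_le (hw : ((p : ℕ) : 𝓞 K) ∉ w.asIdeal)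
    {σ : absoluteGaloisGroup (w.adicCompletion K)} {e : ℕ} {u₀ : ℤ_[p]ˣ} (hσ : (κ (resGalOfEmb (closureEmb (K := K) (w.adicCompletion K)) σ)).toAdd = (p : ℤ_[p]) ^ e * u₀) (n k : ℕ) :
    Finite (semilocCoh S κ θ' P w n k 1) ∧
      Nat.card (semilocCoh S κ θ' P w n k 1) ≤
        (Nat.card (coeffRepK S θ' P k).toTopRep * Nat.card ((coeffRepK S θ' P k).toTopRep →+ MuCarrier (w.adicCompletion K) (p ^ k))) ^ p ^ e := by
  haveI : CharZero (w.adicCompletion K) := charZero_of_injective_algebraMap (algebraMap K (w.adicCompletion K)).injective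
  haveI : NeZero (p ^ k) := ⟨pow_ne_zero _ (Fact.out : p.Prime).ne_zero⟩
  haveI := SmallImageRttD2J2Delta.finite_coeffGSO P S θ' k
  haveI hfinΩ : Finite (MuCarrier (w.adicCompletion K) (p ^ k)) := finite_muCarrier (w.adicCompletion K) (p ^ k)
  haveI : Finite (absoluteGaloisGroup K ⧸ κ.layerSubgroup n → (coeffRepK S θ' P k).toTopRep) :=
    ContinuousRep.finite_coindOpen (κ.layerSubgroup n) (κ.isOpen_layerSubgroup n)
  haveI : Finite (absoluteGaloisGroup K ⧸ κ.layerSubgroup e) := Subgroup.quotient_finite_of_isOpen _ (κ.isOpen_layerSubgroup e)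
  letI : Fintype (absoluteGaloisGroup K ⧸ κ.layerSubgroup e) := Fintype.ofFinite _
  haveI : Finite ((coeffRepK S θ' P k).toTopRep →+ MuCarrier (w.adicCompletion K) (p ^ k)) :=
    Finite.of_injective (fun g ↦ (g : (coeffRepK S θ' P k).toTopRep → MuCarrier (w.adicCompletion K) (p ^ k))) DFunLike.coe_injective
  let res := resGalOfEmb (closureEmb (K := K) (w.adicCompletion K))
  let ρn := ((coeffRepK S θ' P k).coindOpen (κ.layerSubgroup n) (κ.isOpen_layerSubgroup n)).restrict res
  refine ⟨finite_semilocCoh_one S κ θ' P w n k, ?_⟩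
  -- the coefficients are killed by `p^k`, prime to the residue characteristic of `K_w`
  have hM : ∀ φ : absoluteGaloisGroup K ⧸ κ.layerSubgroup n → (coeffRepK S θ' P k).toTopRep, p ^ k • φ = 0 := fun φ ↦ by
    funext y
    rw [Pi.smul_apply, Pi.zero_apply, ← natCast_zsmul, Nat.cast_pow]
    exact coeffGSO_torsion S P θ' k _
  have hpk : ((p ^ k : ℕ) : 𝓞 K) ∉ w.asIdeal := fun h ↦ hw (by rw [Nat.cast_pow] at h; exact w.isPrime.mem_of_pow_mem k h)
  have hn := Literature.NumberTheory.GaloisCohomology.PoitouTateFinite.GaloisImage.UnramifiedCup.ringChar_residueField_not_dvd_of_not_mem (p ^ k) w hpk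
  -- the orbit representatives (honda g28)
  have hr : ∀ y : absoluteGaloisGroup K ⧸ κ.layerSubgroup n, ∃ (h : absoluteGaloisGroup (w.adicCompletion K)) (d : absoluteGaloisGroup K ⧸ κ.layerSubgroup e),
      y = res h • (QuotientGroup.mk d.out : absoluteGaloisGroup K ⧸ κ.layerSubgroup n) := fun y ↦ by
    obtain ⟨t, d, h⟩ := exists_pow_smul_mk_out_eq κ hσ n y
    exact ⟨σ ^ t, d, by rw [map_pow]; exact h⟩
  have hι : Fintype.card (absoluteGaloisGroup K ⧸ κ.layerSubgroup e) = p ^ e := by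
    rw [← Nat.card_eq_fintype_card, ← Subgroup.index_eq_card, κ.index_layerSubgroup]
  -- invariants: orbit count (§1)
  have h0 := natCard_invariants_restrict_coindOpen_le (coeffRepK S θ' P k) (κ.layerSubgroup n) (κ.isOpen_layerSubgroup n) res
    (fun d : absoluteGaloisGroup K ⧸ κ.layerSubgroup e ↦ (QuotientGroup.mk d.out : absoluteGaloisGroup K ⧸ κ.layerSubgroup n)) hr
  -- `H²`: honda's orbit count for `Hom` with the trivial element `τ = 1`
  have h1 := natCard_invariants_homRep_coindOpen_le (coeffRepK S θ' P k) (κ.layerSubgroup n) (κ.isOpen_layerSubgroup n) res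
    (mu (w.adicCompletion K) (p ^ k)) (fun d : absoluteGaloisGroup K ⧸ κ.layerSubgroup e ↦ (QuotientGroup.mk d.out : absoluteGaloisGroup K ⧸ κ.layerSubgroup n)) hr
    1 (fun y ↦ by rw [map_one, one_smul])
  rw [hι] at h0 h1
  -- Euler characteristic and local duality (2,0)
  have hEP := natCard_invariants_mul_natCard_two_eq_of_not_dvd (w.adicCompletion K) (p ^ k) hn ρn hM
  obtain ⟨-, h2⟩ := natCard_two_eq_natCard_invariants_homRep (w.adicCompletion K) ρn hM
  have hfinal : Nat.card ρn.toTopRep.ρ.invariants * Nat.card (continuousCohomology 2 ρn.toTopRep) ≤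
      (Nat.card (coeffRepK S θ' P k).toTopRep * Nat.card ((coeffRepK S θ' P k).toTopRep →+ MuCarrier (w.adicCompletion K) (p ^ k))) ^ p ^ e := by
    rw [h2, mul_pow]
    exact Nat.mul_le_mul h0 (h1.trans (Nat.pow_le_pow_left (Finite.card_subtype_le _) _))
  rw [hEP] at hfinal
  exact hfinal

/-- **(B) in `∃`-form for `k = 1`**: at a finitely decomposed `w ∤ p` the mod-`p` levels `Lloc_w(n,1)` are uniformly bounded in `n` — hypothesis `hB` of
`SemilocIwasawaCohomologyDataO.moduleFinite_padicInt_of_levels`. [cite: MilneADT2006, I §2 Thm. 2.8] [cite: PerrinRiou1994Invent, §1.3] -/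
theorem exists_bound_semilocCoh_one (hw : ((p : ℕ) : 𝓞 K) ∉ w.asIdeal)
    {σ : absoluteGaloisGroup (w.adicCompletion K)} {e : ℕ} {u₀ : ℤ_[p]ˣ} (hσ : (κ (resGalOfEmb (closureEmb (K := K) (w.adicCompletion K)) σ)).toAdd = (p : ℤ_[p]) ^ e * u₀) :
    ∃ B : ℕ, ∀ n : ℕ, Nat.card (semilocCoh S κ θ' P w n 1 1) ≤ B :=
  ⟨_, fun n ↦ (finite_and_natCard_semilocCoh_one_le S κ θ' P w hw hσ n 1).2⟩

end Bound

end Summit.BirchSwinnertonDyer.BirchSwinnertonDyer.Theorems.SmallImageRttD2Seq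

end
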